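import Summits.BirchSwinnertonDyer.Rank1Residual.GaloisImage.KolyvaginPrimeFrobeniusClass
import Summits.BirchSwinnertonDyer.Rank1Residual.GaloisImage.KolyvaginDeepSubclassTransport
import Summits.BirchSwinnertonDyer.Rank1Residual.GaloisImage.ExoticNoHigherLevelTau
import HarnessLib

/-!
# Sakamoto's `τ`-class does not depend on the admissible `τ` (under surjectivity), and the class
# of a deeper `τ′` lies inside the class of a shallower `τ`
# (cell `b2b-bsdres`, team n1011, ROUTE-1 R1-45 (c) tower packaging, row T-R1-45 FILE B; seat p18)

HONEST FRAMING (verbatim for the cell): research route on the CONSTRUCTION-SHAPED class `X4` /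
N11; prove what is provable now; nothing booked; no mark / label moved.  TOOL theorems only — no
definition, no named fact.

## What is proved and why

The END theorem of sub-route (a′) (`Assembly.padicValRat_le_of_certificate_of_transport`, p271924)
takes a shallow Kolyvagin datum `D` at depth `k` and deep data `D′_{k′}` at EVERY depth with
`D′_{k′}.primes ⊆ D.primes`.  The tower supplies an admissible `τ_{k′}` AT EACH DEPTH
(`exists_rootsOfUnityFixer_cokerSubOne_equiv_of_towerSurj`), not one `τ` for all depths; so the
packaging (R1-45 (c)) needs the classes of two different admissible elements to be comparable:

* `FrobShape.frobeniusClassPrimes_subset_of_surj` / `…_eq_of_surj` — for `ρ_{E,p^K}` ONTO and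
  `τ, τ′ ∈ Gal(ℚ̄/ℚ(μ_{p^K}))` both with (H.2) `E[p^K]/(· − 1) ≃ ℤ/p^K`:
  `frobeniusClassPrimes ρ S τ (p^K) = frobeniusClassPrimes ρ S τ′ (p^K)`.  Proof = the proof of
  p275986's membership theorem with the Frobenius witness of `v ∈ 𝒫(τ′)` in place of the Kolyvagin
  Frobenius: `ρ(τ) − 1` and `ρ(τ′) − 1` both have Sakamoto's shape
  (`Unipotent.sq_eq_zero_and_exists_addOrderOf_eq`, Weil pairing), hence are conjugate by some
  `γ ∈ Aut E[p^K]` (`Unipotent.exists_addEquiv_conj_of_sq_eq_zero`); surjectivity AT EXACTLY `p^K`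
  lifts `γ` to `g ∈ Γ_ℚ`, and `g σ g⁻¹` is a Frobenius at `v` acting as `τ` on `E[p^K]` and on
  `μ_{p^K}`.
* `FrobShape.nonempty_cokerSubOne_equiv_zmod_pow_mul_of_le` — an admissible `τ′` at depth `k′`
  is admissible at every depth `k ≤ k′` (N11 spelling of p13's `nonempty_cokerSubOne_equiv_zmod_pow_of_le`).
* `FrobShape.frobeniusClassPrimes_pow_mul_subset_of_le` — for `k ≤ k′`, `τ` admissible at
  `p^{k+1}`, `τ′` admissible at `p^{k′+1}`, `ρ_{E,p^{k+1}}` onto: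
  `𝒫_{k′+1}(τ′) ⊆ 𝒫_{k+1}(τ)` (cc-typer-1's `S24Deep.frobeniusClassPrimes_torsion_pow_mul_mono`
  for the same `τ′`, then the independence at depth `k`) — the supplier of `hPP′` with a per-depth `τ`.

References: R. Sakamoto, JTNB 36 (2024) §2, (H.2) and the set `𝒫` [Sakamoto2024]; J. H. Silverman,
*AEC* (2009) III.8.1 [SilvermanAEC2009].
-/

noncomputable section

open scoped Classical Pointwise
open NumberField IsDedekindDomain IsDedekindDomain.HeightOneSpectrum Field WeierstrassCurve
open Literature.NumberTheory.EllipticCurves Literature.NumberTheory.GaloisRepresentations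
open Literature.NumberTheory.GaloisCohomology Rat.HeightOneSpectrum

namespace Summit.BirchSwinnertonDyer.Rank1Residual.GaloisImage.FrobShape

/-- **The shape (H.2) of an admissible `τ` in additive-automorphism currency**: for
`τ ∈ Gal(ℚ̄/ℚ(μ_{p^K}))` with `E[p^K]/(τ − 1) ≃ ℤ/p^K`, the endomorphism `u_τ − 1` of `E[p^K]`
squares to zero and takes a value of order `p^K` (`Unipotent.sq_eq_zero_and_exists_addOrderOf_eq`
with the Weil pairing). [cite: Sakamoto2024, §2 (H.2) (p. 921)] [cite: SilvermanAEC2009, Prop. III.8.1] -/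
theorem sq_eq_zero_and_exists_addOrderOf_eq_of_admissible (W : WeierstrassCurve ℚ) [W.IsElliptic]
    (p : ℕ) [hp : Fact p.Prime] {K : ℕ} (hK : 0 < K)
    {τ : absoluteGaloisGroup ℚ} (hτμ : τ ∈ rootsOfUnityFixer ℚ (p ^ K))
    (hτq : Nonempty (cokerSubOne (W.torsionGaloisModule ((p ^ K : ℕ) : ℤ)) τ ≃+ ZMod (p ^ K))) :
    (∀ P : geomTorsion W (p ^ K : ℕ), τ • (τ • P - P) - (τ • P - P) = 0) ∧
      ∃ w : geomTorsion W (p ^ K : ℕ), addOrderOf (τ • w - w) = p ^ K := by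
  have h2 : 2 ≤ p ^ K := le_trans hp.out.two_le (Nat.le_self_pow hK.ne' p)
  have hN0 : ((p ^ K : ℕ) : ℚ) ≠ 0 := by exact_mod_cast pow_ne_zero K hp.out.ne_zero
  obtain ⟨F⟩ := nonempty_geomTorsion_addEquiv_prod W hN0
  haveI : Finite (geomTorsion W (p ^ K : ℕ)) := Finite.of_equiv _ F.symm.toEquiv
  obtain ⟨e, hpow, haddl, haddr, halt, hnd, hinv⟩ := exists_invariant_pairing W (p ^ K) h2
  set uτ : geomTorsion W (p ^ K : ℕ) ≃+ geomTorsion W (p ^ K : ℕ) :=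
    (galoisRepTorsion W (p ^ K : ℕ) τ).toAdd with huτ
  have hτq' : Nonempty (geomTorsion W (p ^ K : ℕ) ⧸
      (uτ.toAddMonoidHom - AddMonoidHom.id _).range ≃+ ZMod (p ^ K)) := by
    have heq : (W.torsionGaloisModule ((p ^ K : ℕ) : ℤ) τ).toAddMonoidHom = uτ.toAddMonoidHom :=
      AddMonoidHom.ext fun P => rfl
    rw [← heq]
    exact hτq
  obtain ⟨hsq, w, hw⟩ := Unipotent.sq_eq_zero_and_exists_addOrderOf_eq hK F.symm uτ hτq' e hpow
    haddl haddr halt hnd (hinv τ hτμ)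
  exact ⟨fun P => hsq P, w, hw⟩

/-- **Sakamoto's class does not depend on the admissible `τ`, one inclusion.**  `E/ℚ`, `K ≥ 1`,
`ρ_{E,p^K}` ONTO `Aut(E[p^K])`, `τ, τ′ ∈ Gal(ℚ̄/ℚ(μ_{p^K}))` both with (H.2): then
`frobeniusClassPrimes ρ S τ′ (p^K) ⊆ frobeniusClassPrimes ρ S τ (p^K)`.  The Frobenius `σ` witnessing
`v ∈ 𝒫(τ′)` acts on `E[p^K]` as `τ′`; `ρ(τ′) − 1` and `ρ(τ) − 1` have the same shape, hence are
conjugate by `ρ(g)` for some `g ∈ Γ_ℚ` (surjectivity at exactly `p^K`), and `g σ g⁻¹` is a Frobenius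
at `v` acting as `τ` on `E[p^K]` and on `μ_{p^K}`.  (`n = p^K` as an integer, any spelling.)
[cite: Sakamoto2024, §2, the set 𝒫 and (H.2) (pp. 920–921)] [cite: SilvermanAEC2009, Prop. III.8.1] -/
theorem frobeniusClassPrimes_subset_of_surj (W : WeierstrassCurve ℚ) [W.IsElliptic]
    (p : ℕ) [hp : Fact p.Prime] {K : ℕ} (hK : 0 < K) (n : ℤ) (hn : n = ((p ^ K : ℕ) : ℤ))
    (hsurj : W.HasSurjectiveModNGaloisRep n)
    {τ τ' : absoluteGaloisGroup ℚ} (hτμ : τ ∈ rootsOfUnityFixer ℚ (p ^ K))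
    (hτq : Nonempty (cokerSubOne (W.torsionGaloisModule n) τ ≃+ ZMod (p ^ K)))
    (hτμ' : τ' ∈ rootsOfUnityFixer ℚ (p ^ K))
    (hτq' : Nonempty (cokerSubOne (W.torsionGaloisModule n) τ' ≃+ ZMod (p ^ K)))
    (S : Set (HeightOneSpectrum (𝓞 ℚ))) :
    frobeniusClassPrimes (W.torsionGaloisModule n) S τ' (p ^ K) ⊆
      frobeniusClassPrimes (W.torsionGaloisModule n) S τ (p ^ K) := by
  subst hn
  intro v hv
  obtain ⟨hvS, hNv, hunr, σ₀, ⟨𝔓₀, h𝔓₀, hσ₀⟩, hfix, hμ⟩ := hv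
  -- the module, its frame
  have hN0 : ((p ^ K : ℕ) : ℚ) ≠ 0 := by exact_mod_cast pow_ne_zero K hp.out.ne_zero
  obtain ⟨F⟩ := nonempty_geomTorsion_addEquiv_prod W hN0
  haveI : Finite (geomTorsion W (p ^ K : ℕ)) := Finite.of_equiv _ F.symm.toEquiv
  -- the shapes of `τ` and `τ′`
  obtain ⟨hsqτ, wτ, hwτ⟩ := sq_eq_zero_and_exists_addOrderOf_eq_of_admissible W p hK hτμ hτq
  obtain ⟨hsqτ', wτ', hwτ'⟩ := sq_eq_zero_and_exists_addOrderOf_eq_of_admissible W p hK hτμ' hτq'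
  -- `σ₀` acts on `E[p^K]` as `τ′`
  have hστ' : ∀ P : geomTorsion W (p ^ K : ℕ), σ₀ • P = τ' • P := fun P => by
    have h := hfix (τ' • P)
    rw [torsionGaloisModule_apply_apply, mul_smul, inv_smul_smul] at h
    exact h
  -- the shapes in additive-endomorphism currency
  set uτ : geomTorsion W (p ^ K : ℕ) ≃+ geomTorsion W (p ^ K : ℕ) :=
    (galoisRepTorsion W (p ^ K : ℕ) τ).toAdd with huτ
  set uτ' : geomTorsion W (p ^ K : ℕ) ≃+ geomTorsion W (p ^ K : ℕ) :=
    (galoisRepTorsion W (p ^ K : ℕ) τ').toAdd with huτ'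
  have hsqF : ∀ P, (uτ.toAddMonoidHom - AddMonoidHom.id (geomTorsion W (p ^ K : ℕ)))
      ((uτ.toAddMonoidHom - AddMonoidHom.id (geomTorsion W (p ^ K : ℕ))) P) = 0 := hsqτ
  have hsqF' : ∀ P, (uτ'.toAddMonoidHom - AddMonoidHom.id (geomTorsion W (p ^ K : ℕ)))
      ((uτ'.toAddMonoidHom - AddMonoidHom.id (geomTorsion W (p ^ K : ℕ))) P) = 0 := hsqτ'
  have hwF : addOrderOf ((uτ.toAddMonoidHom - AddMonoidHom.id (geomTorsion W (p ^ K : ℕ))) wτ) =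
      p ^ K := hwτ
  have hwF' : addOrderOf ((uτ'.toAddMonoidHom - AddMonoidHom.id (geomTorsion W (p ^ K : ℕ))) wτ') =
      p ^ K := hwτ'
  -- conjugacy `γ u_{τ′} = u_τ γ`, realised by `g ∈ Γ_ℚ`
  obtain ⟨hNv', hcardV⟩ := Unipotent.nsmul_eq_zero_and_card_of_frame F.symm
  obtain ⟨γ, hγ⟩ := Unipotent.exists_addEquiv_conj_of_sq_eq_zero hcardV hNv' _ _ hsqF' hsqF hwF' hwF
  have hγ' : ∀ P : geomTorsion W (p ^ K : ℕ), γ (τ' • P) = τ • γ P := fun P => by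
    have h := hγ P
    change γ (τ' • P - P) = τ • γ P - γ P at h
    rw [map_sub] at h
    exact sub_left_injective h
  obtain ⟨g, hg⟩ := hsurj (Multiplicative.ofAdd γ)
  have hgP : ∀ P : geomTorsion W (p ^ K : ℕ), g • P = γ P := fun P => by
    rw [← galoisRepTorsion_apply, hg]; rfl
  have hginv : ∀ P : geomTorsion W (p ^ K : ℕ), g⁻¹ • P = γ.symm P := fun P => by
    rw [inv_smul_eq_iff, hgP, AddEquiv.apply_symm_apply]
  -- the Frobenius `σ := g σ₀ g⁻¹`
  refine ⟨hvS, hNv, hunr, g * σ₀ * g⁻¹, ⟨g • 𝔓₀, smul_mem_primesAbove h𝔓₀ g, hσ₀.conj g⟩, ?_, ?_⟩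
  · -- `σ τ⁻¹` acts trivially on `E[p^K]`
    intro P
    rw [torsionGaloisModule_apply_apply, mul_smul, mul_smul, mul_smul, hginv, hστ', hgP, hγ',
      AddEquiv.apply_symm_apply, smul_inv_smul]
  · -- `σ τ⁻¹` fixes `μ_{p^K}`
    intro ζ hζ
    have hτinv : τ⁻¹ • ζ = ζ :=
      (mem_rootsOfUnityFixer_iff.mp ((rootsOfUnityFixer ℚ (p ^ K)).inv_mem hτμ)) ζ hζ
    have hζ' : (g⁻¹ • ζ) ^ (p ^ K) = 1 := by rw [← smul_pow', hζ, smul_one]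
    have hσζ : σ₀ • (g⁻¹ • ζ) = g⁻¹ • ζ := by
      have h1 := hμ (g⁻¹ • ζ) hζ'
      have h2 : τ'⁻¹ • (g⁻¹ • ζ) = g⁻¹ • ζ :=
        (mem_rootsOfUnityFixer_iff.mp ((rootsOfUnityFixer ℚ (p ^ K)).inv_mem hτμ')) _ hζ'
      rw [mul_smul, h2] at h1
      exact h1
    rw [mul_smul, hτinv, mul_smul, mul_smul, hσζ, smul_inv_smul]

/-- **Sakamoto's class does not depend on the admissible `τ`** (under `ρ_{E,p^K}` onto): for
`τ, τ′ ∈ Gal(ℚ̄/ℚ(μ_{p^K}))` both with (H.2),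
`frobeniusClassPrimes ρ S τ (p^K) = frobeniusClassPrimes ρ S τ′ (p^K)`.
[cite: Sakamoto2024, §2, the set 𝒫 and (H.2) (pp. 920–921)] -/
theorem frobeniusClassPrimes_eq_of_surj (W : WeierstrassCurve ℚ) [W.IsElliptic]
    (p : ℕ) [Fact p.Prime] {K : ℕ} (hK : 0 < K) (n : ℤ) (hn : n = ((p ^ K : ℕ) : ℤ))
    (hsurj : W.HasSurjectiveModNGaloisRep n)
    {τ τ' : absoluteGaloisGroup ℚ} (hτμ : τ ∈ rootsOfUnityFixer ℚ (p ^ K))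
    (hτq : Nonempty (cokerSubOne (W.torsionGaloisModule n) τ ≃+ ZMod (p ^ K)))
    (hτμ' : τ' ∈ rootsOfUnityFixer ℚ (p ^ K))
    (hτq' : Nonempty (cokerSubOne (W.torsionGaloisModule n) τ' ≃+ ZMod (p ^ K)))
    (S : Set (HeightOneSpectrum (𝓞 ℚ))) :
    frobeniusClassPrimes (W.torsionGaloisModule n) S τ (p ^ K) =
      frobeniusClassPrimes (W.torsionGaloisModule n) S τ' (p ^ K) :=
  Set.Subset.antisymm (frobeniusClassPrimes_subset_of_surj W p hK n hn hsurj hτμ' hτq' hτμ hτq S)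
    (frobeniusClassPrimes_subset_of_surj W p hK n hn hsurj hτμ hτq hτμ' hτq' S)

/-- **An admissible `τ′` at depth `k′` is admissible at every depth `k ≤ k′`** (N11 spelling
`E[p^k · p]` of p13's `nonempty_cokerSubOne_equiv_zmod_pow_of_le`): `E[p^{k′+1}]/(τ′ − 1) ≃ ℤ/p^{k′+1}`
gives `E[p^{k+1}]/(τ′ − 1) ≃ ℤ/p^{k+1}`. [folklore] -/
theorem nonempty_cokerSubOne_equiv_zmod_pow_mul_of_le (W : WeierstrassCurve ℚ) [W.IsElliptic]
    {p : ℕ} (hp : p.Prime) {k k' : ℕ} (hk : k ≤ k') (τ : absoluteGaloisGroup ℚ)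
    (h : Nonempty (cokerSubOne (W.torsionGaloisModule ((p : ℤ) ^ k' * (p : ℤ))) τ ≃+
      ZMod (p ^ (k' + 1)))) :
    Nonempty (cokerSubOne (W.torsionGaloisModule ((p : ℤ) ^ k * (p : ℤ))) τ ≃+ ZMod (p ^ (k + 1))) := by
  have e1 : (p : ℤ) ^ k' * (p : ℤ) = (p : ℤ) ^ (k' + 1) := (pow_succ _ _).symm
  have e2 : (p : ℤ) ^ k * (p : ℤ) = (p : ℤ) ^ (k + 1) := (pow_succ _ _).symm
  rw [e2]
  rw [e1] at h
  exact nonempty_cokerSubOne_equiv_zmod_pow_of_le W hp (by omega) τ h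

/-- **The class of a deeper `τ′` lies inside the class of a shallower `τ`** — the `hPP′` supplier
with a PER-DEPTH `τ`.  For `k ≤ k′`, `τ` admissible at `p^{k+1}` (fixes `μ_{p^{k+1}}`, (H.2) on
`E[p^{k+1}]`), `τ′` admissible at `p^{k′+1}`, and `ρ_{E,p^{k+1}}` onto:
`frobeniusClassPrimes ρ_{E,p^{k′+1}} S τ′ (p^{k′+1}) ⊆ frobeniusClassPrimes ρ_{E,p^{k+1}} S τ (p^{k+1})`
(cc-typer-1's `S24Deep.frobeniusClassPrimes_torsion_pow_mul_mono` for the same `τ′`, then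
`frobeniusClassPrimes_subset_of_surj` at depth `k`, where `τ′` is admissible too).
[cite: Sakamoto2024, §2, the set 𝒫 and (H.2) (pp. 920–921)] -/
theorem frobeniusClassPrimes_pow_mul_subset_of_le (W : WeierstrassCurve ℚ) [W.IsElliptic]
    (p : ℕ) [hp : Fact p.Prime] {k k' : ℕ} (hk : k ≤ k')
    (hsurj : W.HasSurjectiveModNGaloisRep ((p : ℤ) ^ k * (p : ℤ)))
    {τ τ' : absoluteGaloisGroup ℚ} (hτμ : τ ∈ rootsOfUnityFixer ℚ (p ^ (k + 1)))
    (hτq : Nonempty (cokerSubOne (W.torsionGaloisModule ((p : ℤ) ^ k * (p : ℤ))) τ ≃+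
      ZMod (p ^ (k + 1))))
    (hτμ' : τ' ∈ rootsOfUnityFixer ℚ (p ^ (k' + 1)))
    (hτq' : Nonempty (cokerSubOne (W.torsionGaloisModule ((p : ℤ) ^ k' * (p : ℤ))) τ' ≃+
      ZMod (p ^ (k' + 1))))
    (S : Set (HeightOneSpectrum (𝓞 ℚ))) :
    frobeniusClassPrimes (W.torsionGaloisModule ((p : ℤ) ^ k' * (p : ℤ))) S τ' (p ^ (k' + 1)) ⊆
      frobeniusClassPrimes (W.torsionGaloisModule ((p : ℤ) ^ k * (p : ℤ))) S τ (p ^ (k + 1)) := by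
  have hdvd : p ^ (k + 1) ∣ p ^ (k' + 1) := pow_dvd_pow p (Nat.succ_le_succ hk)
  refine (S24Deep.frobeniusClassPrimes_torsion_pow_mul_mono W (p : ℤ) hk S τ' hdvd).trans ?_
  exact frobeniusClassPrimes_subset_of_surj W p (Nat.succ_pos k) _ (by push_cast; rw [pow_succ]) hsurj
    hτμ hτq (rootsOfUnityFixer_le_of_dvd ℚ hdvd hτμ')
    (nonempty_cokerSubOne_equiv_zmod_pow_mul_of_le W hp.out hk τ' hτq') S

end Summit.BirchSwinnertonDyer.Rank1Residual.GaloisImage.FrobShape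

end
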